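import Literature.MathematicalPhysics.QuantumLattice.KomaPiFluxLROGroundState
import Literature.MathematicalPhysics.QuantumLattice.KomaTasakiU1FieldBound
import HarnessLib

/-!
# Koma 2022 eq. (2.15): the `π`-flux BCS lattice-fermion model acquires a spontaneous superconducting
# "magnetization" under an infinitesimal symmetry-breaking field (Koma–Tasaki 1993 Theorem 7.3 BY NAME)

T. Koma, *Nambu–Goldstone modes for superconducting lattice fermions*, arXiv:2201.13135 (2022) [Koma2022],
§2, (2.13)–(2.15): the finite-volume ground state under the symmetry-breaking field `B`,
`ω^{(Λ)}_{B,g'}(⋯) := lim_{β↗∞} ⟨⋯⟩^{(Λ)}_{β,B}` (2.13), the infinite-volume state `ω_{0,g'}` (2.14), and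
"Actually, there appears a spontaneous magnetization in the sense that [33]
`|Λ|⁻¹ ω_{0,g'}(O^{(Λ)}) ≥ μ > 0` (2.15) for a large `Λ`, where `μ` is a positive constant" — [33] being
T. Koma, H. Tasaki, Commun. Math. Phys. 158 (1993) 191 [KomaTasaki1993], Theorem 7.3:
`liminf_{B↓0} liminf_{Λ↑ℤ^d} N⁻¹(Φ_Λ(B), O^{(1)}_ΛΦ_Λ(B)) ≥ √2 σ` (7.11) for EVERY ground state `Φ_Λ(B)` of
`H_Λ - B·O^{(1)}_Λ`, where `σ` is the long-range order of the symmetric ground states (7.1).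

This file proves (2.15), with the explicit constant `μ = 1/√1000` and for EVERY `B > 0` (the volume limit taken
first, as in (7.11) and (2.14)), by composing tree theorems:
KT93 Theorem 7.3 for abstract Koma–Tasaki `U(1)` systems (`KomaTasaki.komaTasakiU1Field_u1`,
`KomaTasakiU1FieldBound.lean`) ∘ the instance `KomaPiFlux.ktSystem` (`KomaPiFluxKomaTasakiSystem.lean`) ∘ the
long-range-ordered ground eigenstate `KomaPiFlux.exists_lro_groundState_coulomb` (`KomaPiFluxLROGroundState.lean`,
from [Koma2022] Theorem 2.1: `σ² = groundLroSq ≥ 1/2000`, hence `√2σ ≥ √2/√2000 = 1/√1000`).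

* **`KomaPiFlux.spontaneousOrder_coulomb`** (Lieb frame): `D = d+1 ≥ 3`, `g > 0`, `|κ| ≤ g/1000`,
  `0 ≤ g' ≤ g/2000`, `U + 2gD ≤ 0`; for every `B > 0` and `ε > 0` there is `k₁` such that on every torus of side
  `2k`, `k ≥ k₁`, EVERY unit ground state `Φ_B` of the sourced Hamiltonian `hamiltonianC κ U g g' 0 B = H - B·Σ_xΓ²_x`
  has `|Λ|⁻¹ Re Φ_B†(Σ_xΓ²_x)Φ_B ≥ 1/√1000 - ε`;
* `KomaPiFlux.spontaneousOrder_coulomb_groundStateFunctional` — the same for the tracial sourced ground state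
  `ω_GS` (uniform mixture of the ground states of `H - B·O`), and
  **`KomaPiFlux.spontaneousOrder_coulomb_zeroTemperature`** — Koma's (2.13) literally: the zero-temperature
  limit `lim_{β→∞} |Λ|⁻¹Re⟨Σ_xΓ²_x⟩_{β, H - B·O}` exists and is `≥ 1/√1000 - ε`;
* **`KomaPiFlux.printed_spontaneousOrder_coulomb`** — the PRINTED frame: for Koma's Hamiltonian (2.4) with the full
  interaction (2.6) (`printedHamiltonianC κ g g' 0 B`, which contains the source `-B·O^{(Λ)}` with the staggered
  order parameter `O^{(Λ)} = Σ_x(-1)^{x(1)+⋯+x(d)}Γ²_x` of (2.5), `printedOrder`) and `|κ| ≤ g/1000`, `0 ≤ g' ≤ g/2000`: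
  `lim_{β↗∞} |Λ|⁻¹ ⟨O^{(Λ)}⟩^{(Λ)}_{β,B} ≥ 1/√1000 - ε` on all large even tori — (2.15) with `μ = 1/√1000 - ε` for
  every `B > 0`; `printed_spontaneousOrder` is the `g' = 0` case.

Direction, as everywhere in this family: long-range order (reflection positivity) ⟹ symmetry breaking under the
field; no claim is made about `B = 0` one-point functions (they vanish) nor about the converse.  The infinite-volume
formulation (2.14)–(2.15) (weak-* limits `Λ↗ℤ^d` then `B↘0`) follows from the `ε`–`k₁` statements for every fixed
`B > 0` by translation covariance of the torus states and is not restated here.  No named facts; every statement is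
proved; constants: `κ̂ = 1/1000`, `ĝ' = 1/2000` as in the tree's Theorem 2.1, `μ = 1/√1000`.

## References

* [Koma2022] T. Koma, arXiv:2201.13135, Theorem 2.1, (2.4)–(2.6), (2.11)–(2.15), (3.3), (6.5).
* [KomaTasaki1993] T. Koma, H. Tasaki, Commun. Math. Phys. 158 (1993) 191–214, §7, Theorem 7.3 (7.11), (7.5).
* [KomaTasaki1994] T. Koma, H. Tasaki, J. Stat. Phys. 76 (1994) 745–803, §2.3, Theorem 2.5 (2.30).
* [Tasaki2020] H. Tasaki, *Physics and Mathematics of Quantum Many-Body Systems*, Springer 2020, §2.1, App. A.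
-/

noncomputable section

namespace Literature.MathematicalPhysics.QuantumLattice

open _root_.Matrix Finset Filter Topology HubbardWave0 PairHopRP FermionTorus LiebCutRP WithLp
open Literature.Probability.LatticeModels
open scoped Matrix.Norms.L2Operator InnerProductSpace ComplexConjugate ComplexOrder

namespace KomaPiFlux

attribute [local instance] LiebCutRP.decEqTorus

open KT

variable {d L : ℕ} [NeZero L]

/-! ### Constants -/

/-- `√2 · (√a/2) · 2 = √(2a)`. [cite: KomaTasaki1993, Theorem 7.3 (7.11)] -/
private theorem sqrt_two_mul_mu (a : ℝ) : Real.sqrt 2 * (Real.sqrt a / 2) * 2 = Real.sqrt (2 * a) := by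
  rw [Real.sqrt_mul (by norm_num : (0:ℝ) ≤ 2) a]; ring

/-- `0 < √a/2 ≤ 1` for `0 < a ≤ 1`. [cite: KomaTasaki1994, §2.3 iv)] -/
private theorem mu_pos_le_one {a : ℝ} (ha : 0 < a) (ha1 : a ≤ 1) : 0 < Real.sqrt a / 2 ∧ Real.sqrt a / 2 ≤ 1 := by
  have h1 : Real.sqrt a ≤ 1 := by
    rw [show (1:ℝ) = Real.sqrt 1 by simp]
    exact Real.sqrt_le_sqrt ha1
  exact ⟨by positivity, by linarith⟩

/-- `√(2/2000) = 1/√1000`. [cite: Koma2022, (2.15)] -/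
theorem sqrt_two_div_two_thousand : Real.sqrt (2 * (1 / 2000)) = 1 / Real.sqrt 1000 := by
  rw [show (2 : ℝ) * (1 / 2000) = 1 / 1000 by norm_num, Real.sqrt_div' 1 (by norm_num : (0:ℝ) ≤ 1000), Real.sqrt_one]

/-- `|Λ| = (2k)^{d+1} ≥ k`. [cite: Koma2022, (2.1)] -/
theorem le_card_torus (k : ℕ) [NeZero (2 * k)] : k ≤ Fintype.card (FermionTorus (d + 1) (2 * k)) := by
  rw [card_fermionTorus]
  calc k ≤ 2 * k := by omega
    _ = (2 * k) ^ 1 := (pow_one _).symm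
    _ ≤ (2 * k) ^ (d + 1) := Nat.pow_le_pow_right (Nat.pos_of_ne_zero (NeZero.ne _)) (by omega)

/-! ### The engine: long-range order of the symmetric ground states ⟹ order `≥ √2σ` under the field -/

/-- **KT93 Theorem 7.3 for Koma's model, from a long-range-order floor (the engine).**  If on every torus of
side `2k`, `k ≥ k₀`, the tracial ground state of `H = hamiltonianC κ U g g' 0 0` has `groundLroSq H ≥ a`
(`0 < a ≤ 1`; `σ² = a` in the normalisation `o = 2`), then for every `B > 0` and `ε > 0` there is `k₁` such that on
every torus of side `2k`, `k ≥ k₁`, EVERY unit ground state `Φ_B` of `H - B·Σ_xΓ²_x` has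
`|Λ|⁻¹ Re Φ_B†(Σ_xΓ²_x)Φ_B ≥ √(2a) - ε`.  Composition of `exists_groundState_eigenvector_of_groundLroSq`,
`ktSystem_isLROEigenstate` and `KomaTasaki.komaTasakiU1Field_u1`. [cite: KomaTasaki1993, Theorem 7.3 (7.11), (7.5)] [cite: Koma2022, (2.15)] -/
theorem spontaneousOrder_of_groundLroSq {κ U g g' a : ℝ} (ha : 0 < a) (ha1 : a ≤ 1) {k₀ : ℕ}
    (hlro : ∀ k : ℕ, k₀ ≤ k → ∀ [NeZero (2 * k)],
      a ≤ groundLroSq (hamiltonianC κ U g g' (fun (_ _ : FermionTorus (d + 1) (2 * k)) => (0 : ℝ)) 0))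
    {B ε : ℝ} (hB : 0 < B) (hε : 0 < ε) :
    ∃ k₁ : ℕ, ∀ k : ℕ, k₁ ≤ k → ∀ [NeZero (2 * k)],
      ∀ ΦB : Idx d (2 * k) → ℂ, star ΦB ⬝ᵥ ΦB = 1 →
        hamiltonianC κ U g g' (fun (_ _ : FermionTorus (d + 1) (2 * k)) => (0 : ℝ)) B *ᵥ ΦB =
          ((hamiltonianC κ U g g' (fun (_ _ : FermionTorus (d + 1) (2 * k)) => (0 : ℝ)) B).groundEnergy : ℂ) • ΦB →
        Real.sqrt (2 * a) - ε ≤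
          (star ΦB ⬝ᵥ (orderParameter *ᵥ ΦB)).re / (Fintype.card (FermionTorus (d + 1) (2 * k)) : ℝ) := by
  set μ : ℝ := Real.sqrt a / 2 with hμ_def
  obtain ⟨N₀, hN₀⟩ := KomaTasaki.komaTasakiU1Field_u1.{0, 0} μ 2 (hbarConst d κ U g g') (2 * (d + 1) + 1) hB hε
  refine ⟨max k₀ N₀, fun k hk _ ΦB hΦB hHB => ?_⟩
  have hk₀k : k₀ ≤ k := le_trans (le_max_left _ _) hk
  have hN₀k : N₀ ≤ Fintype.card (FermionTorus (d + 1) (2 * k)) :=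
    le_trans (le_trans (le_max_right _ _) hk) (le_card_torus k)
  -- the long-range-ordered ground eigenstate and hypothesis iv)
  set H₀ := hamiltonianC κ U g g' (fun (_ _ : FermionTorus (d + 1) (2 * k)) => (0 : ℝ)) 0 with hH₀
  have hH₀herm : H₀.IsHermitian := hamiltonianC_isHermitian κ U g g' _ 0
  obtain ⟨Φ, hΦ, hHΦ, ⟨ν, hNΦ⟩, hlroΦ⟩ := exists_groundState_eigenvector_of_groundLroSq hH₀herm
    (PairHopRP.commute_totalNumber_hamiltonianC_zero (G d (2 * k)) (piFluxAmpl κ) U g g') (hlro k hk₀k)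
  set sys := ktSystem (d := d) (L := 2 * k) κ U g g' with hsys
  have hlro' : (μ * 2 * (Fintype.card (FermionTorus (d + 1) (2 * k)) : ℝ)) ^ 2 ≤
      (star Φ ⬝ᵥ ((∑ x : FermionTorus (d + 1) (2 * k), gammaOne x) *ᵥ
        ((∑ x : FermionTorus (d + 1) (2 * k), gammaOne x) *ᵥ Φ))).re := by
    have hμ2 : (μ * 2) ^ 2 = a := by
      rw [hμ_def, div_mul_cancel₀ _ (two_ne_zero), Real.sq_sqrt ha.le]
    calc (μ * 2 * (Fintype.card (FermionTorus (d + 1) (2 * k)) : ℝ)) ^ 2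
        = a * (Fintype.card (FermionTorus (d + 1) (2 * k)) : ℝ) ^ 2 := by rw [mul_pow, hμ2]
      _ ≤ _ := hlroΦ
  have hLRO : KomaTasaki.IsLROEigenstate sys (toLp 2 Φ) H₀.groundEnergy μ :=
    ktSystem_isLROEigenstate κ U g g' hΦ hHΦ hNΦ (mu_pos_le_one ha ha1).1 (mu_pos_le_one ha ha1).2 hlro'
  -- the ground-state hypotheses
  have hground : ∀ ψ : EuclideanSpace ℂ (Idx d (2 * k)), ‖ψ‖ = 1 → H₀.groundEnergy ≤ (⟪ψ, sys.hamiltonian ψ⟫_ℂ).re := by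
    intro ψ hψ
    rw [hsys, ktSystem_hamiltonian]
    exact Matrix.groundEnergy_le_re_inner_toEuclideanCLM' hH₀herm ψ hψ
  set HB := hamiltonianC κ U g g' (fun (_ _ : FermionTorus (d + 1) (2 * k)) => (0 : ℝ)) B with hHB_def
  have hHBherm : HB.IsHermitian := hamiltonianC_isHermitian κ U g g' _ B
  have hfield : sys.hamiltonian - (B : ℂ) • sys.order 0 = toEuclideanCLM (n := Idx d (2 * k)) (𝕜 := ℂ) HB := by
    rw [hsys, ktSystem_field]
  have hmin : ∀ ψ : EuclideanSpace ℂ (Idx d (2 * k)), ‖ψ‖ = 1 →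
      (⟪(toLp 2 ΦB : EuclideanSpace ℂ (Idx d (2 * k))), (sys.hamiltonian - (B : ℂ) • sys.order 0) (toLp 2 ΦB)⟫_ℂ).re ≤
        (⟪ψ, (sys.hamiltonian - (B : ℂ) • sys.order 0) ψ⟫_ℂ).re := by
    intro ψ hψ
    rw [hfield]
    exact Matrix.re_inner_toEuclideanCLM_le_of_groundState hHBherm hΦB hHB ψ hψ
  -- KT93 Theorem 7.3
  have h := hN₀ sys (toLp 2 Φ) H₀.groundEnergy hLRO rfl le_rfl le_rfl hground hN₀k (toLp 2 ΦB)
    (norm_toLp_eq_one_of_dotProduct hΦB) hmin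
  rw [sqrt_two_mul_mu a, hsys, ktSystem_order_zero, toEuclideanCLM_toLp, inner_toLp_toLp_eq_dotProduct] at h
  exact h

/-- **The engine, tracial form**: under the same long-range-order floor, the tracial sourced ground state
(uniform mixture of the ground states of `H - B·O`) has `|Λ|⁻¹ Re ω_GS(Σ_xΓ²_x) ≥ √(2a) - ε` on all large even tori.
[cite: KomaTasaki1993, Theorem 7.3] [cite: Koma2022, (2.13), (2.15)] -/
theorem spontaneousOrder_groundStateFunctional_of_groundLroSq {κ U g g' a : ℝ} (ha : 0 < a) (ha1 : a ≤ 1) {k₀ : ℕ}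
    (hlro : ∀ k : ℕ, k₀ ≤ k → ∀ [NeZero (2 * k)],
      a ≤ groundLroSq (hamiltonianC κ U g g' (fun (_ _ : FermionTorus (d + 1) (2 * k)) => (0 : ℝ)) 0))
    {B ε : ℝ} (hB : 0 < B) (hε : 0 < ε) :
    ∃ k₁ : ℕ, ∀ k : ℕ, k₁ ≤ k → ∀ [NeZero (2 * k)],
      Real.sqrt (2 * a) - ε ≤
        ((hamiltonianC κ U g g' (fun (_ _ : FermionTorus (d + 1) (2 * k)) => (0 : ℝ)) B).groundStateFunctional
            orderParameter).re / (Fintype.card (FermionTorus (d + 1) (2 * k)) : ℝ) := by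
  obtain ⟨k₁, hk₁⟩ := spontaneousOrder_of_groundLroSq ha ha1 hlro hB hε
  refine ⟨k₁, fun k hk _ => ?_⟩
  set HB := hamiltonianC κ U g g' (fun (_ _ : FermionTorus (d + 1) (2 * k)) => (0 : ℝ)) B with hHB_def
  have hHBherm : HB.IsHermitian := hamiltonianC_isHermitian κ U g g' _ B
  -- a ground state of `H_B` minimising the order parameter among the mixture
  obtain ⟨Φ, hΦ, hHΦ, -, hO⟩ :=
    Matrix.exists_groundState_eigenvector_re_ge hHBherm hHBherm rfl (-orderParameter)
  have h := hk₁ k hk Φ hΦ hHΦ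
  rw [map_neg, Complex.neg_re, neg_mulVec, dotProduct_neg, Complex.neg_re, neg_le_neg_iff] at hO
  have hcard : (0 : ℝ) < (Fintype.card (FermionTorus (d + 1) (2 * k)) : ℝ) := by
    exact_mod_cast Fintype.card_pos
  exact h.trans (div_le_div_of_nonneg_right hO hcard.le)

/-- **The engine, zero-temperature form** (Koma's (2.13)): `lim_{β→∞} |Λ|⁻¹Re⟨Σ_xΓ²_x⟩_{β,H-B·O}` exists and is
`≥ √(2a) - ε` on all large even tori. [cite: Koma2022, (2.13), (2.15)] [cite: KomaTasaki1993, Theorem 7.3] -/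
theorem spontaneousOrder_zeroTemperature_of_groundLroSq {κ U g g' a : ℝ} (ha : 0 < a) (ha1 : a ≤ 1) {k₀ : ℕ}
    (hlro : ∀ k : ℕ, k₀ ≤ k → ∀ [NeZero (2 * k)],
      a ≤ groundLroSq (hamiltonianC κ U g g' (fun (_ _ : FermionTorus (d + 1) (2 * k)) => (0 : ℝ)) 0))
    {B ε : ℝ} (hB : 0 < B) (hε : 0 < ε) :
    ∃ k₁ : ℕ, ∀ k : ℕ, k₁ ≤ k → ∀ [NeZero (2 * k)], ∃ m : ℝ,
      Tendsto (fun β : ℝ => (gibbsState β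
          (hamiltonianC κ U g g' (fun (_ _ : FermionTorus (d + 1) (2 * k)) => (0 : ℝ)) B) orderParameter).re /
            (Fintype.card (FermionTorus (d + 1) (2 * k)) : ℝ)) atTop (𝓝 m) ∧
        Real.sqrt (2 * a) - ε ≤ m := by
  obtain ⟨k₁, hk₁⟩ := spontaneousOrder_groundStateFunctional_of_groundLroSq ha ha1 hlro hB hε
  refine ⟨k₁, fun k hk _ => ⟨_, ?_, hk₁ k hk⟩⟩
  have hH : (hamiltonianC κ U g g' (fun (_ _ : FermionTorus (d + 1) (2 * k)) => (0 : ℝ)) B).IsHermitian :=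
    hamiltonianC_isHermitian κ U g g' _ B
  exact ((Complex.continuous_re.tendsto _).comp (Matrix.tendsto_gibbsState_atTop_holds hH _)).div_const _

/-! ### (2.15) in Lieb's frame, `D ≥ 3` -/

/-- **Koma 2022 (2.15) / KT93 Theorem 7.3 for the `π`-flux BCS model with Coulomb repulsion, Lieb frame, EVERY
sourced ground state.**  In `D = d+1 ≥ 3` directions, for `g > 0`, `|κ| ≤ g/1000`, `0 ≤ g' ≤ g/2000`, `U + 2gD ≤ 0`,
every field `B > 0` and every `ε > 0` there is `k₁` such that on every torus of side `2k`, `k ≥ k₁`, every unit ground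
state `Φ_B` of `H - B·Σ_xΓ²_x` (`= hamiltonianC κ U g g' 0 B`) satisfies
`|Λ|⁻¹ Re Φ_B†(Σ_xΓ²_x)Φ_B ≥ 1/√1000 - ε`. [cite: Koma2022, (2.15), Theorem 2.1] [cite: KomaTasaki1993, Theorem 7.3 (7.11)] -/
theorem spontaneousOrder_coulomb (hd : 2 ≤ d) {κ U g g' : ℝ} (hg : 0 < g) (hκg : |κ| ≤ g / 1000)
    (hg'0 : 0 ≤ g') (hg'g : g' ≤ g / 2000) (hU : U + 2 * g * (d + 1) ≤ 0) {B ε : ℝ} (hB : 0 < B) (hε : 0 < ε) :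
    ∃ k₁ : ℕ, ∀ k : ℕ, k₁ ≤ k → ∀ [NeZero (2 * k)],
      ∀ ΦB : Idx d (2 * k) → ℂ, star ΦB ⬝ᵥ ΦB = 1 →
        hamiltonianC κ U g g' (fun (_ _ : FermionTorus (d + 1) (2 * k)) => (0 : ℝ)) B *ᵥ ΦB =
          ((hamiltonianC κ U g g' (fun (_ _ : FermionTorus (d + 1) (2 * k)) => (0 : ℝ)) B).groundEnergy : ℂ) • ΦB →
        1 / Real.sqrt 1000 - ε ≤
          (star ΦB ⬝ᵥ (orderParameter *ᵥ ΦB)).re / (Fintype.card (FermionTorus (d + 1) (2 * k)) : ℝ) := by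
  obtain ⟨k₀, hk₀⟩ := groundState_superconductingOrder_coulomb hd hg hκg hg'0 hg'g hU
  rw [← sqrt_two_div_two_thousand]
  exact spontaneousOrder_of_groundLroSq (by norm_num) (by norm_num) hk₀ hB hε

/-- **(2.15) for the tracial sourced ground state**, `D ≥ 3`: `|Λ|⁻¹ Re ω_GS(Σ_xΓ²_x) ≥ 1/√1000 - ε` on all large
even tori. [cite: Koma2022, (2.13), (2.15)] [cite: KomaTasaki1993, Theorem 7.3] -/
theorem spontaneousOrder_coulomb_groundStateFunctional (hd : 2 ≤ d) {κ U g g' : ℝ} (hg : 0 < g)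
    (hκg : |κ| ≤ g / 1000) (hg'0 : 0 ≤ g') (hg'g : g' ≤ g / 2000) (hU : U + 2 * g * (d + 1) ≤ 0) {B ε : ℝ}
    (hB : 0 < B) (hε : 0 < ε) :
    ∃ k₁ : ℕ, ∀ k : ℕ, k₁ ≤ k → ∀ [NeZero (2 * k)],
      1 / Real.sqrt 1000 - ε ≤
        ((hamiltonianC κ U g g' (fun (_ _ : FermionTorus (d + 1) (2 * k)) => (0 : ℝ)) B).groundStateFunctional
            orderParameter).re / (Fintype.card (FermionTorus (d + 1) (2 * k)) : ℝ) := by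
  obtain ⟨k₀, hk₀⟩ := groundState_superconductingOrder_coulomb hd hg hκg hg'0 hg'g hU
  rw [← sqrt_two_div_two_thousand]
  exact spontaneousOrder_groundStateFunctional_of_groundLroSq (by norm_num) (by norm_num) hk₀ hB hε

/-- **Koma 2022 (2.13) & (2.15), Lieb frame, `D ≥ 3`**: the zero-temperature limit
`ω^{(Λ)}_B(Σ_xΓ²_x) = lim_{β→∞}⟨Σ_xΓ²_x⟩_{β,H-B·O}` exists and `|Λ|⁻¹ ω^{(Λ)}_B(Σ_xΓ²_x) ≥ 1/√1000 - ε` on all large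
even tori. [cite: Koma2022, (2.13), (2.15)] [cite: KomaTasaki1993, Theorem 7.3] -/
theorem spontaneousOrder_coulomb_zeroTemperature (hd : 2 ≤ d) {κ U g g' : ℝ} (hg : 0 < g)
    (hκg : |κ| ≤ g / 1000) (hg'0 : 0 ≤ g') (hg'g : g' ≤ g / 2000) (hU : U + 2 * g * (d + 1) ≤ 0) {B ε : ℝ}
    (hB : 0 < B) (hε : 0 < ε) :
    ∃ k₁ : ℕ, ∀ k : ℕ, k₁ ≤ k → ∀ [NeZero (2 * k)], ∃ m : ℝ,
      Tendsto (fun β : ℝ => (gibbsState β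
          (hamiltonianC κ U g g' (fun (_ _ : FermionTorus (d + 1) (2 * k)) => (0 : ℝ)) B) orderParameter).re /
            (Fintype.card (FermionTorus (d + 1) (2 * k)) : ℝ)) atTop (𝓝 m) ∧
        1 / Real.sqrt 1000 - ε ≤ m := by
  obtain ⟨k₀, hk₀⟩ := groundState_superconductingOrder_coulomb hd hg hκg hg'0 hg'g hU
  rw [← sqrt_two_div_two_thousand]
  exact spontaneousOrder_zeroTemperature_of_groundLroSq (by norm_num) (by norm_num) hk₀ hB hε

/-! ### (2.15) as printed: Koma's Hamiltonian (2.4) with (2.6) and the staggered order parameter (2.5) -/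

/-- **The sourced Gibbs expectation of the printed order parameter equals the Lieb-frame one**:
`⟨O^{(Λ)}⟩_{β, H(B)} = ⟨Σ_xΓ²_x⟩_{β, H_Lieb(κ,-2Dg;g,g';0;B)}` (`H(B) = printedHamiltonianC κ g g' 0 B = 𝒰H_Lieb𝒰† - c·1`,
`O^{(Λ)} = 𝒰(Σ_xΓ²_x)𝒰†`). [cite: Koma2022, (2.4)–(2.6), (2.10), (6.5)] -/
theorem gibbsState_printedOrder_eq (hL : Even L) (h4 : 4 ≤ L) (β κ g g' B : ℝ) :
    gibbsState β (printedHamiltonianC κ g g' (fun (_ : Fin (d + 1)) (_ : FermionTorus (d + 1) L) => (0 : ℝ)) B) printedOrder =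
      gibbsState β (hamiltonianC κ (-2 * (d + 1 : ℕ) * g) g g' (fun (_ _ : FermionTorus (d + 1) L) => (0 : ℝ)) B)
        orderParameter := by
  set H₀ := hamiltonianC κ (-2 * (d + 1 : ℕ) * g) g g' (fun (_ _ : FermionTorus (d + 1) L) => (0 : ℝ)) B with hH₀
  have key := orbitalPhaseAut_hamiltonianC_eq_printed hL h4 κ g g'
    (fun (_ : Fin (d + 1)) (_ : FermionTorus (d + 1) L) => (0 : ℝ)) B
  rw [bondField_zero, ← hH₀] at key
  set c : ℝ := (d + 1 : ℕ) * g * Fintype.card (FermionTorus (d + 1) L) / 2 with hc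
  have hprinted : printedHamiltonianC κ g g' (fun (_ : Fin (d + 1)) (_ : FermionTorus (d + 1) L) => (0 : ℝ)) B =
      orbitalPhaseAut (g := spinSitePhase komaPhase) (fun _ => norm_komaPhase _ _) H₀ + ((-c : ℝ) : ℂ) • 1 := by
    rw [key, Complex.ofReal_neg, neg_smul, add_neg_cancel_right]
  have hO : (printedOrder : Matrix (Finset (Orb (FermionTorus (d + 1) L))) _ ℂ) =
      orbitalPhaseAut (g := spinSitePhase komaPhase) (fun _ => norm_komaPhase _ _) orderParameter :=
    orbitalPhaseAut_orderParameter_eq_printed.symm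
  have key2 := Matrix.gibbsState_unitary_conj'
    (orbitalPhase_mem_unitary (g := spinSitePhase (komaPhase (d := d) (L := L))) fun _ => norm_komaPhase _ _) β H₀
    orderParameter
  rw [star_eq_conjTranspose, ← orbitalPhaseAut_apply (fun _ => norm_komaPhase _ _),
    ← orbitalPhaseAut_apply (fun _ => norm_komaPhase _ _)] at key2
  rw [hprinted, hO, Matrix.gibbsState_add_real_smul_one, key2]

/-- **Koma 2022 eq. (2.15), as printed, with the Coulomb repulsion.**  Let `D = d+1 ≥ 3`, `g > 0`, `|κ| ≤ g/1000`,
`0 ≤ g' ≤ g/2000` (the parameter region of the tree's Theorem 2.1, `κ̂ = 1/1000`, `ĝ' = 1/2000`).  For every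
symmetry-breaking field `B > 0` and every `ε > 0` there is `k₁` such that on every torus of side `2k`, `k ≥ k₁`, the
finite-volume ground state (2.13) `ω^{(Λ)}_{B,g'} = lim_{β↗∞}⟨⋯⟩^{(Λ)}_{β,B}` of Koma's Hamiltonian (2.4) (hopping
(2.7)–(2.9), interaction (2.6), source `-B·O^{(Λ)}` with the staggered order parameter (2.5)) exists on `O^{(Λ)}` and
`|Λ|⁻¹ ω^{(Λ)}_{B,g'}(O^{(Λ)}) ≥ 1/√1000 - ε` — "there appears a spontaneous magnetization".
[cite: Koma2022, (2.13)–(2.15), Theorem 2.1] [cite: KomaTasaki1993, Theorem 7.3 (7.11)] -/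
theorem printed_spontaneousOrder_coulomb (hd : 2 ≤ d) {κ g g' : ℝ} (hg : 0 < g) (hκg : |κ| ≤ g / 1000)
    (hg'0 : 0 ≤ g') (hg'g : g' ≤ g / 2000) {B ε : ℝ} (hB : 0 < B) (hε : 0 < ε) :
    ∃ k₁ : ℕ, ∀ k : ℕ, k₁ ≤ k → ∀ [NeZero (2 * k)], ∃ m : ℝ,
      Tendsto (fun β : ℝ => (gibbsState β
          (printedHamiltonianC κ g g' (fun (_ : Fin (d + 1)) (_ : FermionTorus (d + 1) (2 * k)) => (0 : ℝ)) B)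
            printedOrder).re / (Fintype.card (FermionTorus (d + 1) (2 * k)) : ℝ)) atTop (𝓝 m) ∧
        1 / Real.sqrt 1000 - ε ≤ m := by
  have hU : (-2 * (d + 1 : ℕ) * g : ℝ) + 2 * g * (d + 1) ≤ 0 := by push_cast; linarith
  obtain ⟨k₁, hk₁⟩ := spontaneousOrder_coulomb_zeroTemperature hd hg hκg hg'0 hg'g hU hB hε
  refine ⟨max k₁ 2, fun k hk _ => ?_⟩
  obtain ⟨m, hm, hle⟩ := hk₁ k (le_trans (le_max_left _ _) hk)
  refine ⟨m, ?_, hle⟩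
  refine hm.congr' (Eventually.of_forall fun β => ?_)
  simp only [gibbsState_printedOrder_eq (even_two_mul k) (by omega)]

/-- **Koma 2022 eq. (2.15), as printed, `g' = 0`.** [cite: Koma2022, (2.13)–(2.15), Theorem 2.1] [cite: KomaTasaki1993, Theorem 7.3 (7.11)] -/
theorem printed_spontaneousOrder (hd : 2 ≤ d) {κ g : ℝ} (hg : 0 < g) (hκg : |κ| ≤ g / 1000) {B ε : ℝ}
    (hB : 0 < B) (hε : 0 < ε) :
    ∃ k₁ : ℕ, ∀ k : ℕ, k₁ ≤ k → ∀ [NeZero (2 * k)], ∃ m : ℝ,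
      Tendsto (fun β : ℝ => (gibbsState β
          (printedHamiltonian κ g (fun (_ : Fin (d + 1)) (_ : FermionTorus (d + 1) (2 * k)) => (0 : ℝ)) B)
            printedOrder).re / (Fintype.card (FermionTorus (d + 1) (2 * k)) : ℝ)) atTop (𝓝 m) ∧
        1 / Real.sqrt 1000 - ε ≤ m := by
  obtain ⟨k₁, hk₁⟩ := printed_spontaneousOrder_coulomb hd hg hκg le_rfl (by positivity) hB hε
  refine ⟨k₁, fun k hk _ => ?_⟩
  obtain ⟨m, hm, hle⟩ := hk₁ k hk
  refine ⟨m, ?_, hle⟩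
  refine hm.congr' (Eventually.of_forall fun β => ?_)
  simp only [printedHamiltonianC_zero]

end KomaPiFlux

end Literature.MathematicalPhysics.QuantumLattice

end
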